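import Summits.QuantumFields.BalabanUV.Beta.FP.TowerFTransportWardRecord
import Summits.QuantumFields.BalabanUV.Beta.FP.TowerFAnchorWardRecord
import Summits.QuantumFields.BalabanUV.Beta.FP.TowerFTransportRowW
import Summits.QuantumFields.BalabanUV.Beta.FP.TowerFAnchorRowW
import Summits.QuantumFields.BalabanUV.Beta.FP.TowerFWeightRecLoc

/-!
# `BalabanUV.Beta.FP.TowerFRowsTrueWeight` — road «FP», binder row D1, ROUTE T, the (H5-F) option (3a) (SPEC-64 §22 (2); an2 g85 W-3 (a) ∕ W-5 (3) CO-SIGNED):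
# **THE END CONSUMER's F-ROWS `hF₁ ∕ htr` AT THE RENORMALISED TRUE WEIGHT `(α j)⁻¹ • wF`, FROM THE DISPLAYED RESIDUE ONLY** — the kernel certificate that the (3a) F-side
# closes `…PairingSummable`'s `hF₁` (L.361) and `htr` (L.364) TEXTS given `hgauge` (∀ j), `hW𝒯` (j ≥ 1), `hζ` and nothing else (every other letter BY NAME: an2 PART 96∕97, road g61∕g62)

WHY (journal A-7 l.69226; SPEC-64 §22 (2) «the (3a) F-side by-name table»).  The `--dressF` END skeleton instantiates v10's F-family at the lambda weight
`w j := fun c μ p => (α j)⁻¹ * wF Lc Q ℓ sn j c μ p` (an2 PART 96 `wF`, A-5 ∕ W-3 (a) packaging) and must produce the consumer's two F-rows.  THIS FILE is that composition,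
stated as two theorems whose hypotheses are EXACTLY the displayed residue of the census line: `hgauge` (the weight difference to `wStep Lc (j+1)` is a backward fine gradient of
ONE potential `ζ j a` per coarse source — (J-W″), by value A2-HQF0), `hζ` (its moments), `hW𝒯` (the printed Ward identity of the record's composite one-loop kernel, j ≥ 1 — by value
TEL2 C10 ∕ R-FP-62-WARD (W2)); the brick bound `hℓb` of PART 97 is kept generic here (both row tokens discharge it: `abs_linKerAt_le ∕ abs_symLinKerAt_le`, PART 97 §5).  Chain:
road g61 `htr_rec_w ∕ hF₁_rec_w` (the rows for ANY exponentially localised weight, `hwloc := TowerFWeightRecLoc.hwloc_mul_wF`) ⟶ road g62 `htr_of_gauge_of_ward` (storeys ≥ 1: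
`DressedEntryWardInvariance` v2 + `TowerNKernelIndexSymmetry`) ∕ `hF₁_of_anchor_of_gauge` (storey 0: the table half is the tree theorem `wardRefl_JsB12CombShSym_an1TablesS2_pinned_of_locks` +
`indexSymmetric_TbalOf_JsB12CombShSym`, FINDING FP-70 (b)); weight moments by PART 97 v1.3 `absMoment₂_mul_wF`.

WHAT ([folklore] composition BY NAME; no `def`, no `def … : Prop`, nothing cited, 0 sorry): **`htr_trueWeight`** — `∀ j ≥ 1, ∀ μ ν z, hessKer (σ′ⱼ-chart) (𝒱F_w j) (𝒲F_w j) μ ν z =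
Lc^8 · dressedEntry (wStep Lc (j+1)) (hessKer (AN ctr j) (VN ctr Pn j) (WN ctr Pn j)) ((Lc:ℤ)•z) μ ν` with `𝒱F_w ∕ 𝒲F_w` the σ′-scaled `Lc⁴ • dressV ∕ Lc⁸ • dressW` families AT `w j`
(`TowerFTransportRowW`'s left side with `w j ↦` the lambda); **`hF₁_trueWeight`** — the anchor row at `w 0` with the consumer's right side `Lc^8 · dressedEntry (wStep Lc 1) (TshotOf … 1) ((Lc:ℤ)•z) μ ν`
from `hgauge 0`, `hζ 0` and M‴'s scalars (`Odd Lc`, `2 ≤ Lc`, `2 ≤ N`, the two unit locks).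
WHAT THIS IS NOT: not `hgauge`, `hW𝒯`, `hζ` (DISPLAYED); not the END (the skeleton composes these two with the other 200 binders; xread); nothing of Bałaban's asserted, valued or
discharged; 0 estimates; 0∕4 row-D1 binders (hW, hR, D1Tel, D1Rep); NOT (C1), NOT (T-ID), NOT D1, NEVER «G-an2-4 closed», NOT BetaPertH, NOT continuum, NOT Clay.

HONEST DEPENDENCY (page 1, mandatory): continuum YM on T⁴ ⇐ BetaPertH ∧ nine spine estimates (0/9 proved); BetaPertH ⇐ (D1) ∧ (D4) ∧ CAP+tail;
G-an2-4 gates asym, D1 and NE2/3/4.  HONEST FRAMING (cell contract, verbatim): «discharging `BetaPertH` makes Bałaban's UV stability UNCONDITIONAL —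
a real constructive-QFT result; it is NOT the continuum limit and NOT the Clay problem.»  ABSOLUTE RULE (cell charter, verbatim): «No internally-minted
statement may enter as a cited fact. Every hypothesis is either kernel-proved in this package or a verbatim quotation of a PUBLISHED theorem with page
reference. The manuscript(s) under audit are NOT citable for their own disputed steps — they are the thing under adjudication; programme-internal
(2001/route/tribunal) claims are never citable.»  Road «FP» OWNER, b2b-balaban-beta-d1-p3 gen 62, 2026-08-30.  No existing file touched.
-/

noncomputable section

open scoped BigOperators

namespace Summit.QuantumFields.BalabanUV.Beta.FP.TowerFRowsTrueWeight

open Finset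
open Literature.MathematicalPhysics.QuantumFieldTheory
open Literature.MathematicalPhysics.QuantumFieldTheory.Balaban1983to89
open Literature.MathematicalPhysics.QuantumFieldTheory.Balaban1983to89.Beta
open B12Sec2to5 (l1)
open AffineAveraging (Site)
open AveragingHessianKernels (Bond)
open ExpKernelCalculus (MKer hessKer)
open DecimatedMomentSummable (AbsMoment₂)
open DressedMomentNormalisation (EKer dressedEntry)
open HessKerRate (scaleK)
open HessianTelescopingKKT (wStep)
open OneStepResolventKernel (Fib)
open OneStepKernelFamily (vertexOfK TshotOf flipK)
open PolarizationSign (WardTransversal)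
open Summit.QuantumFields.BalabanUV.Beta.SymSecondOrderTablesAn1 (symTablesAn1S2)
open Summit.QuantumFields.BalabanUV.Beta.CombChartStepJets (GcombSh JsB12CombSh0)
open Summit.QuantumFields.BalabanUV.Beta.CompositeOneShotJetData (Roots Pins AN VN WN JcComp)
open Summit.QuantumFields.BalabanUV.Beta.FP.TorusCompositeObjectsG (StepRows)
open Summit.QuantumFields.BalabanUV.Beta.FP.KernelStepDressing (dressV dressW)
open Summit.QuantumFields.BalabanUV.Beta.FP.TowerFWeightRecDefs (wF)
open Summit.QuantumFields.BalabanUV.Beta.FP.TowerFWeightRecLoc (hwloc_mul_wF absMoment₂_mul_wF)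
open Summit.QuantumFields.BalabanUV.Beta.FP.TowerFTransportRowW (htr_rec_w)
open Summit.QuantumFields.BalabanUV.Beta.FP.TowerFAnchorRowW (hF₁_rec_w)
open Summit.QuantumFields.BalabanUV.Beta.FP.TowerFTransportWardRecord (htr_of_gauge_of_ward)
open Summit.QuantumFields.BalabanUV.Beta.FP.TowerFAnchorWardRecord (hF₁_of_anchor_of_gauge)

variable (Lc : ℕ) [NeZero Lc] (hLc : Odd Lc) (N : ℕ) (cΛ cB : ℝ) (Pn : Pins) (uF : ℕ → ℝ)
  (Q : StepRows 3 Lc) (ℓ : Fin (3 + 1) → Site (3 + 1) → Bond (3 + 1) → ℝ) (sn α : ℕ → ℝ) {Bℓ : ℝ}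

/-! ## §1 Storeys `j ≥ 1`: the transport row at the true weight, from `hgauge` and `hW𝒯` -/

/-- [folklore] **`htr_trueWeight` — THE END CONSUMER's `htr` UNDER (3a).**  At the renormalised true weight `w j := fun c μ p => (α j)⁻¹ * wF Lc Q ℓ sn j c μ p` the σ′-scaled dressed
F-families satisfy `…PairingSummable`'s `htr` TEXT, given the gauge letters `hgauge j`, the Ward letters `hW𝒯 j` (j ≥ 1) and the moment letters `hζ j` — road g61 `htr_rec_w` (with
`hwloc := hwloc_mul_wF`) composed with road g62 `htr_of_gauge_of_ward` (weight moments `absMoment₂_mul_wF`). -/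
theorem htr_trueWeight (hB : 0 ≤ Bℓ) (hℓb : ∀ (μ : Fin (3 + 1)) (y : Site (3 + 1)) (f : Bond (3 + 1)), |ℓ μ y f| ≤ Bℓ) (huF : ∀ j, uF j ≠ 0)
    (ζ : ℕ → Fin 4 → (Fin 4 → ℤ) → ℝ) (hζ : ∀ j a, AbsMoment₂ (ζ j a))
    (hgauge : ∀ j : ℕ, 1 ≤ j → ∀ (c a : Fin 4) (u : Fin 4 → ℤ), (α j)⁻¹ * wF Lc Q ℓ sn j c a u - wStep Lc (j + 1) c a u = ζ j a (u - Pi.single c 1) - ζ j a u)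
    (hW𝒯 : ∀ j : ℕ, 1 ≤ j → WardTransversal (flipK (hessKer (AN (Roots.ctr Lc) j) (VN (Roots.ctr Lc) Pn j) (WN (Roots.ctr Lc) Pn j)))) :
    ∀ j : ℕ, 1 ≤ j → ∀ (μ ν : Fin 4) (z : Fin 4 → ℤ),
      hessKer (scaleK (Sum.elim (fun _ : Fin (3 + 1) => (1 : ℝ)) (fun _ : Fin (3 + 1) => (uF j)⁻¹)) (Sum.elim (fun _ : Fin (3 + 1) => (1 : ℝ)) (fun _ : Fin (3 + 1) => (uF j)⁻¹)) (AN (Roots.ctr Lc) j)) (fun μ y => scaleK (Sum.elim (fun _ : Fin (3 + 1) => (1 : ℝ)) (fun _ : Fin (3 + 1) => (uF j))) (Sum.elim (fun _ : Fin (3 + 1) => (1 : ℝ)) (fun _ : Fin (3 + 1) => (uF j))) ((Lc : ℝ) ^ 4 • dressV (Lc ^ (j + 1)) Lc ((fun (k : ℕ) (c μ : Fin (3 + 1)) (p : Fin (3 + 1) → ℤ) => (α k)⁻¹ * wF Lc Q ℓ sn k c μ p) j) (VN (Roots.ctr Lc) Pn j) μ y)) (fun μ y ν y' => scaleK (Sum.elim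 (fun _ : Fin (3 + 1) => (1 : ℝ)) (fun _ : Fin (3 + 1) => (uF j))) (Sum.elim (fun _ : Fin (3 + 1) => (1 : ℝ)) (fun _ : Fin (3 + 1) => (uF j))) ((Lc : ℝ) ^ 8 • dressW (Lc ^ (j + 1)) Lc ((fun (k : ℕ) (c μ : Fin (3 + 1)) (p : Fin (3 + 1) → ℤ) => (α k)⁻¹ * wF Lc Q ℓ sn k c μ p) j) (WN (Roots.ctr Lc) Pn j) μ y ν y')) μ ν z
        = (Lc : ℝ) ^ 8 * dressedEntry (wStep Lc (j + 1)) (hessKer (AN (Roots.ctr Lc) j) (VN (Roots.ctr Lc) Pn j) (WN (Roots.ctr Lc) Pn j)) ((Lc : ℤ) • z) μ ν :=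
  htr_of_gauge_of_ward (Roots.ctr Lc) Pn (fun (k : ℕ) (c μ : Fin (3 + 1)) (p : Fin (3 + 1) → ℤ) => (α k)⁻¹ * wF Lc Q ℓ sn k c μ p) ζ
    (fun j κ l => absMoment₂_mul_wF Lc Q sn hB hℓb ((α j)⁻¹) j κ l) hζ hgauge hW𝒯
    (fun j μ ν z => hessKer (scaleK (Sum.elim (fun _ : Fin (3 + 1) => (1 : ℝ)) (fun _ : Fin (3 + 1) => (uF j)⁻¹)) (Sum.elim (fun _ : Fin (3 + 1) => (1 : ℝ)) (fun _ : Fin (3 + 1) => (uF j)⁻¹)) (AN (Roots.ctr Lc) j)) (fun μ y => scaleK (Sum.elim (fun _ : Fin (3 + 1) => (1 : ℝ)) (fun _ : Fin (3 + 1) => (uF j))) (Sum.elim (fun _ : Fin (3 + 1) => (1 : ℝ)) (fun _ : Fin (3 + 1) => (uF j))) ((Lc : ℝ) ^ 4 • dressV (Lc ^ (j + 1)) Lc ((fun (k : ℕ) (c μ : Fin (3 + 1)) (p : Fin (3 + 1) → ℤ) => (α k)⁻¹ * wF Lc Q ℓ sn k c μ p) j) (VN (Roots.ctr Lc) Pn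 j) μ y)) (fun μ y ν y' => scaleK (Sum.elim (fun _ : Fin (3 + 1) => (1 : ℝ)) (fun _ : Fin (3 + 1) => (uF j))) (Sum.elim (fun _ : Fin (3 + 1) => (1 : ℝ)) (fun _ : Fin (3 + 1) => (uF j))) ((Lc : ℝ) ^ 8 • dressW (Lc ^ (j + 1)) Lc ((fun (k : ℕ) (c μ : Fin (3 + 1)) (p : Fin (3 + 1) → ℤ) => (α k)⁻¹ * wF Lc Q ℓ sn k c μ p) j) (WN (Roots.ctr Lc) Pn j) μ y ν y')) μ ν z)
    (fun j hj μ ν z => htr_rec_w Lc Pn uF (fun (k : ℕ) (c μ : Fin (3 + 1)) (p : Fin (3 + 1) → ℤ) => (α k)⁻¹ * wF Lc Q ℓ sn k c μ p) (hwloc_mul_wF Lc Q ℓ sn hB hℓb (fun k : ℕ => (α k)⁻¹)) huF j hj μ ν z)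

/-! ## §2 Storey `0` (the anchor): the depth-1 row at the true weight, from `hgauge 0` alone -/

/-- [folklore] **`hF₁_trueWeight` — THE END CONSUMER's `hF₁` UNDER (3a).**  At `w 0` the σ′₀-scaled dressed LITERAL pair satisfies `…PairingSummable`'s `hF₁` TEXT given `hgauge 0`,
`hζ 0` and M‴'s scalars only (the anchor table's Ward identity and index symmetry are tree theorems — `TowerFAnchorWardRecord`, FINDING FP-70 (b)) — road g61 `hF₁_rec_w` composed with
road g62 `hF₁_of_anchor_of_gauge`. -/
theorem hF₁_trueWeight (hL2 : 2 ≤ Lc) (hN : 2 ≤ N) (hΛ : cΛ * (Lc : ℝ) ^ 4 = 2) (hcB : cB = -((Lc : ℝ) ^ 12 / 4))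
    (hB : 0 ≤ Bℓ) (hℓb : ∀ (μ : Fin (3 + 1)) (y : Site (3 + 1)) (f : Bond (3 + 1)), |ℓ μ y f| ≤ Bℓ) (huF : uF 0 ≠ 0)
    (ζ : ℕ → Fin 4 → (Fin 4 → ℤ) → ℝ) (hζ : ∀ a, AbsMoment₂ (ζ 0 a))
    (hgauge : ∀ (c a : Fin 4) (u : Fin 4 → ℤ), (α 0)⁻¹ * wF Lc Q ℓ sn 0 c a u - wStep Lc 1 c a u = ζ 0 a (u - Pi.single c 1) - ζ 0 a u) :
    ∀ (μ ν : Fin 4) (z : Fin 4 → ℤ),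
      hessKer (scaleK (Sum.elim (fun _ : Fin (3 + 1) => (1 : ℝ)) (fun _ : Fin (3 + 1) => (uF 0)⁻¹)) (Sum.elim (fun _ : Fin (3 + 1) => (1 : ℝ)) (fun _ : Fin (3 + 1) => (uF 0)⁻¹)) (GcombSh (d := 3) Lc 0)) (fun μ y => scaleK (Sum.elim (fun _ : Fin (3 + 1) => (1 : ℝ)) (fun _ : Fin (3 + 1) => (uF 0))) (Sum.elim (fun _ : Fin (3 + 1) => (1 : ℝ)) (fun _ : Fin (3 + 1) => (uF 0))) ((Lc : ℝ) ^ 4 • dressV Lc Lc ((fun (k : ℕ) (c μ : Fin (3 + 1)) (p : Fin (3 + 1) → ℤ) => (α k)⁻¹ * wF Lc Q ℓ sn k c μ p) 0) (vertexOfK (GcombSh (d := 3) Lc 0) Lc (JsB12CombSh0 hLc N (symTablesAn1S2 3 Lc cΛ) cΛ cB 0).S) μ y)) (fun μ y ν y' => scaleK (Sum.elim (fun _ : Fin (3 + 1) => (1 : ℝ)) (fun _ : Fin (3 + 1) => (uF 0))) (Sum.elim (fun _ : Fin (3 + 1) => (1 : ℝ)) (fun _ : Fin (3 + 1) => (uF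 0))) ((Lc : ℝ) ^ 8 • dressW Lc Lc ((fun (k : ℕ) (c μ : Fin (3 + 1)) (p : Fin (3 + 1) → ℤ) => (α k)⁻¹ * wF Lc Q ℓ sn k c μ p) 0) (JsB12CombSh0 hLc N (symTablesAn1S2 3 Lc cΛ) cΛ cB 0).W μ y ν y')) μ ν z
        = (Lc : ℝ) ^ 8 * dressedEntry (wStep Lc 1) (TshotOf Lc (JcComp hLc N cΛ cB (Roots.ctr Lc) Pn) 1) ((Lc : ℤ) • z) μ ν :=
  hF₁_of_anchor_of_gauge hLc hL2 hN cΛ cB hΛ hcB (Roots.ctr Lc) Pn ((fun (k : ℕ) (c μ : Fin (3 + 1)) (p : Fin (3 + 1) → ℤ) => (α k)⁻¹ * wF Lc Q ℓ sn k c μ p) 0) (ζ 0)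
    (fun κ l => absMoment₂_mul_wF Lc Q sn hB hℓb ((α 0)⁻¹) 0 κ l) hζ hgauge
    (fun μ ν z => hessKer (scaleK (Sum.elim (fun _ : Fin (3 + 1) => (1 : ℝ)) (fun _ : Fin (3 + 1) => (uF 0)⁻¹)) (Sum.elim (fun _ : Fin (3 + 1) => (1 : ℝ)) (fun _ : Fin (3 + 1) => (uF 0)⁻¹)) (GcombSh (d := 3) Lc 0)) (fun μ y => scaleK (Sum.elim (fun _ : Fin (3 + 1) => (1 : ℝ)) (fun _ : Fin (3 + 1) => (uF 0))) (Sum.elim (fun _ : Fin (3 + 1) => (1 : ℝ)) (fun _ : Fin (3 + 1) => (uF 0))) ((Lc : ℝ) ^ 4 • dressV Lc Lc ((fun (k : ℕ) (c μ : Fin (3 + 1)) (p : Fin (3 + 1) → ℤ) => (α k)⁻¹ * wF Lc Q ℓ sn k c μ p) 0) (vertexOfK (GcombSh (d := 3) Lc 0) Lc (JsB12CombSh0 hLc N (symTablesAn1S2 3 Lc cΛ) cΛ cB 0).S) μ y)) (fun μ y ν y' => scaleK (Sum.elim (fun _ : Fin (3 + 1) => (1 : ℝ)) (fun _ : Fin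 (3 + 1) => (uF 0))) (Sum.elim (fun _ : Fin (3 + 1) => (1 : ℝ)) (fun _ : Fin (3 + 1) => (uF 0))) ((Lc : ℝ) ^ 8 • dressW Lc Lc ((fun (k : ℕ) (c μ : Fin (3 + 1)) (p : Fin (3 + 1) → ℤ) => (α k)⁻¹ * wF Lc Q ℓ sn k c μ p) 0) (JsB12CombSh0 hLc N (symTablesAn1S2 3 Lc cΛ) cΛ cB 0).W μ y ν y')) μ ν z)
    (fun μ ν z => hF₁_rec_w Lc hLc N cΛ cB Pn uF (fun (k : ℕ) (c μ : Fin (3 + 1)) (p : Fin (3 + 1) → ℤ) => (α k)⁻¹ * wF Lc Q ℓ sn k c μ p) (hwloc_mul_wF Lc Q ℓ sn hB hℓb (fun k : ℕ => (α k)⁻¹)) huF μ ν z)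

end Summit.QuantumFields.BalabanUV.Beta.FP.TowerFRowsTrueWeight

end
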